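import Summits.BirchSwinnertonDyer.BirchSwinnertonDyer.Theorems.ThetaPartnerAtTwoSignedKatoUpToAtTwoFlatDualRestriction
import Summits.BirchSwinnertonDyer.BirchSwinnertonDyer.Theorems.ThetaPartnerAtTwoSignedKatoUpToAtTwoPointsModelJ
import Summits.BirchSwinnertonDyer.BirchSwinnertonDyer.Theorems.ThetaPartnerAtTwoSignedTransportAtTwoSignedSelmerDescription
import Literature.Algebra.Module.PadicFunctionalSeparation
import Literature.NumberTheory.EllipticCurves.IwasawaAlgebraCharIdealProofs
import Literature.NumberTheory.EllipticCurves.SemistableModPImageAbelianProofs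
import HarnessLib

/-!
# Route `ThetaPartnerAtTwo` (TP2), crux K3 `SignedKatoDivisibilityUpToAtTwo` (item stmt-BirchSwinnertonDyer-20308),
# line `colemanrat` — file 20: **AT `a_p = 0` SPRUNG'S `Sel♭` IS KOBAYASHI'S `Sel⁺`** — the converse inclusion
# `Sel♭(E/K_∞) ≤ Sel⁺(E/K_∞)` (local exact-annihilator theorem, any base; global at `p = 2` over `ℚ`), hence
# `Sel⁺ = Sel♭`, `X♭ ≃ X⁺` as `Λ`-modules, `ℓ_𝔭(X♭) = ℓ_𝔭(X⁺)` and `Char(X♭) = Char(X⁺)` on the PINNED dual data —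
# so the ♭ road of file 19 loses nothing: «♭-Kato divisibility off `2`» ⟺ K3's local form off `2` (modulo HONDA⁺@2)

Width seat `bsd-wall-tp2-p2x-w2` g2 (cell `bsd-wall`). HONEST FRAMING: THEOREMS ONLY — no definition, no named fact, no
instance, no `sorry`; route-independent (no `Theses` import); closes no item; the `p = 2` statements are modulo the plus
Honda clauses (L) (TR) [(GEN) (GEN₀) for the equality] of K4's `stub_plusHondaSystemTwo` and a local lift `g` of the
generator (which exists, `ZpExtension.IsCyclotomic.exists_isTopGenerator_resGalOfEmb_adicCompletion`); BSD is NOT proved by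
any of this.

## Why this file

Files 16–19 built the road `Sel⁺ ≤ Sel♭ ⇒ X♭ ↠ X⁺ ⇒ ℓ_𝔭(X⁺) ≤ ℓ_𝔭(X♭) ⇒ (K3 ⟸ ♭-Kato off 2 + HONDA⁺@2)`. For the route pen's
re-lining decision one must know whether the ♭ statement is STRONGER than K3's. It is not: this file proves the converse
inclusion, so at `a_2 = 0` the two Selmer groups coincide and the pinned duals are isomorphic `Λ`-modules. This is the
tree's form of Sprung's remark that for `a_p = 0` the `♯/♭` theory recovers Kobayashi's `±` theory (J. Number Theory 132
(2012) p. 1486 and Def. 7.9–7.11 with Kobayashi Thm. 6.2 / Prop. 8.18–8.23 «`ker Col⁺` is the exact annihilator of `E⁺`»),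
at every prime INCLUDING `2` granted the Honda clauses.

## The argument (§1, any `K`, `p`, `κ`, `K_v`, `ι`)

A class `c` in Sprung's condition `E♭_{∞}` is the Kummer class of `x ⊗ p^{-k}`, `x = p^k Q ∈ E(K_∞·K_v) =: T`, with
`z(x) ∈ p^k ℤ_p` for every `z ∈ Ker Col♭`. By file 16 (A) (`mem_colemanKer_flat_of_forall_plus`, which needs only (L), (TR) and
`g`) every additive `z : T → ℤ_p` vanishing on `A := ⨆ₙ E⁺(K_n·K_v)` lies in `Ker Col♭`; so every `ℤ_p`-valued functional of
the quotient `T/A` is divisible by `p^k` at the image of `x`. The quotient has no `p`-torsion (`A` is `p`-saturated in `T`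
under (NT), w3's `KummerPoint.iSup_signedLocalPointsOfEmb_saturated`), so PONTRYAGIN DUALITY for `p`-torsion-free groups
(`Literature.Algebra.Module.exists_nsmul_eq_of_forall_addMonoidHom_padicInt_dvd`) gives `x ≡ p^k y (mod A)` with `y ∈ T`;
the witness `Q' := Q − y` has `p^k Q' ∈ A` and the same Kummer cocycle on `Gal(K̄_v/K_∞·K_v)` (which fixes `y`). Hence
`E♭_∞ ≤ (⨆ₙ E⁺_n) ⊗ ℚ_p/ℤ_p` as local conditions over `K_∞` — the converse of file 17 §1.

## What is proved

* §1 `noPTorsion_towerQuotPlus` — `T/A` has no `p`-torsion under (NT); **`sharpFlatLocalKummer_le_localKummerOverOfEmb_iSup_plus`**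
  — the ♭ local condition implies the plus Kummer condition over `K_∞` (hyps: `g`, (NT), (L), (TR));
  `sharpFlatLocalKummer_eq_localKummerOverOfEmb_iSup_plus` — EQUALITY of the two local conditions (adding (IDX), (GEN), (GEN₀)).
* §2 `conjH1_mem_localKummerOverOfEmb_iSup_plus_of_mem_sharpFlatSelmerInfty` (number field `K`) — a class of `Sel♭` is
  plus-Kummer over `K_∞` at every conjugate of the chosen place.
* §3 (`K = ℚ`, `p = 2`) **`sharpFlatSelmerInfty_flat_le_signedSelmerInfty_two`** — `Sel♭(E/ℚ_∞) ≤ Sel⁺(E/ℚ_∞)` for ANY `E/ℚ`, any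
  `ℤ₂`-extension, modulo (`g`, (NT), (L), (TR)) (descent to a finite layer: tp2-p1's `mem_signedSelmerInfty_of_mem_selmerInfty`);
  **`signedSelmerInfty_eq_sharpFlatSelmerInfty_flat_two`** — `Sel⁺ = Sel♭` on the theta habitat (glob. min., `GoodSS W 2`,
  cyclotomic `κ`) modulo HONDA⁺@2 and `g`.
* §4 (any `K`, `p`) under `Sel⁺ = Sel♭`: `flatToPlusRestrict_injective`, `nonempty_linearEquiv_sharpFlat_signed` (`X♭ ≃ₗ[Λ] X⁺` for
  every pinned pair), `lengthAt_sharpFlat_eq_lengthAt_signed`, `charIdeal_sharpFlat_eq_charIdeal_signed`.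
* §5 (`p = 2`, habitat, modulo HONDA⁺@2 + `g`) `lengthAt_sharpFlat_eq_lengthAt_signed_two`, `charIdeal_sharpFlat_eq_charIdeal_signed_two`
  — so the inequality of file 19's hypothesis (F) for `D♭` holds iff K3's off-two inequality (the hypothesis of
  `signedKatoDivisibilityUpToAtTwo_of_offTwo`) holds for `D`, at every `𝔭`: the ♭ road loses nothing.

References: [Kobayashi2003] S. Kobayashi, Invent. Math. 152 (2003), Def. 1.1, §2 p. 4, Thm. 6.2, Prop. 8.18–8.23;
[Sprung2012] F. Sprung, J. Number Theory 132 (2012), §1 p. 1486, Def. 7.9–7.11 (p. 1503), Thm. 7.14 (p. 1504);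
[NeukirchSchmidtWingberg2008] I §1 (1.1.8) (Pontryagin duality).
-/

set_option autoImplicit false
-- the Theorems namespace of this sub repeats the summit name by design (D-0017 nested layout)
set_option linter.dupNamespace false

noncomputable section

open scoped Classical NumberField

universe u

namespace Summit.BirchSwinnertonDyer.BirchSwinnertonDyer.Theorems

namespace SignedKatoOffTwo.FlatKernel

open NumberField IsDedekindDomain WeierstrassCurve Literature.NumberTheory.EllipticCurves
  Literature.NumberTheory.GaloisRepresentations Literature.NumberTheory.EllipticCurves.ZpExtension
  Literature.NumberTheory.EllipticCurves.Kobayashi2003 Literature.NumberTheory.EllipticCurves.Sprung2017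
  Literature.NumberTheory.EllipticCurves.Sprung2012 Literature.NumberTheory.EllipticCurves.Rank1Residual
  Literature.NumberTheory.EllipticCurves.Module

/-! ## §1 The ♭ local condition implies the plus Kummer condition (exact annihilator; any base) -/

section Local

variable {K : Type u} [Field K] {p : ℕ} [hp : Fact p.Prime] (κ : ZpExtension K p)
variable {E : Type u} [Field E] [Algebra K E] (ι : AlgebraicClosure K →ₐ[K] AlgebraicClosure E)
variable (W : WeierstrassCurve K)

/-- **`E(K_∞·K_v) / ⨆ₙ E⁺(K_n·K_v)` has no `p`-torsion** under (NT) «no `p`-torsion in `E(K_∞·K_v)`»: the plus union is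
`p`-saturated in the tower (`KummerPoint.iSup_signedLocalPointsOfEmb_saturated`). [cite: Kobayashi2003, §2 p. 4 and Prop. 8.7] -/
theorem noPTorsion_towerQuotPlus (hnt : ∀ P ∈ localTowerPointsOfEmb κ ι W, p • P = 0 → P = 0)
    (y : ↥(localTowerPointsOfEmb κ ι W) ⧸
      (⨆ n : ℕ, signedLocalPointsOfEmb κ ι W 1 n).addSubgroupOf (localTowerPointsOfEmb κ ι W))
    (hy : p • y = 0) : y = 0 := by
  obtain ⟨y, rfl⟩ := QuotientAddGroup.mk_surjective y
  rw [← QuotientAddGroup.mk_nsmul, QuotientAddGroup.eq_zero_iff, AddSubgroup.mem_addSubgroupOf,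
    AddSubgroupClass.coe_nsmul] at hy
  rw [QuotientAddGroup.eq_zero_iff, AddSubgroup.mem_addSubgroupOf]
  exact KummerPoint.iSup_signedLocalPointsOfEmb_saturated W κ ι hnt 1 _ y.2 hy

/-- **The ♭ condition implies the plus Kummer condition over `K_∞`** (converse of file 17 §1). For `H = ker κ`, the chosen
embedding `ι`, a local lift `g` of the topological generator, (NT), and a Honda system `d` of `a_p = 0` shape ((L) levels,
(TR) `Tr_{m+2/m+1} d_{m+2} = −d_m`): every class whose restriction to `Gal(K̄_v/K_∞·K_v)` is the Kummer class of
`x ⊗ p^{-k}`, `x ∈ E(K_∞·K_v)`, with `z(x) ∈ p^k ℤ_p` for all `z ∈ Ker Col♭`, is the Kummer class of `x' ⊗ p^{-k}` with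
`x' ∈ ⨆ₙ E⁺(K_n·K_v)`: `ann(⨆ₙ E⁺_n) ⊆ Ker Col♭` (file 16 (A)) and Pontryagin duality for the `p`-torsion-free quotient
`E(K_∞·K_v)/⨆ₙ E⁺_n` give `x ∈ ⨆ₙ E⁺_n + p^k E(K_∞·K_v)`, and translating the witness by a point of `E(K_∞·K_v)` does not
change the cocycle. [cite: Kobayashi2003, Thm. 6.2 and Prop. 8.18–8.23 (pp. 18–19)] [cite: Sprung2012, Def. 7.9 (p. 1503)]
[cite: NeukirchSchmidtWingberg2008, I §1 (1.1.8)] -/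
theorem sharpFlatLocalKummer_le_localKummerOverOfEmb_iSup_plus {g : Field.absoluteGaloisGroup E}
    (hg : κ.IsTopGenerator (resGalOfEmb ι g))
    (hnt : ∀ P ∈ localTowerPointsOfEmb κ ι W, p • P = 0 → P = 0)
    {d : ℕ → localPoints W E} (hd : ∀ m, d m ∈ localLayerPointsOfEmb κ ι W m)
    (htr : ∀ m, localTraceOfEmb κ ι W (m + 1) (m + 2) (d (m + 2)) = -d m) :
    sharpFlatLocalKummerOverOfEmb W p κ.kerSubgroup ι (localTowerPointsOfEmb κ ι W) (colemanKer κ ι W 0 g d .flat) ≤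
      localKummerOverOfEmb W p κ.kerSubgroup ι (⨆ n : ℕ, signedLocalPointsOfEmb κ ι W 1 n) := by
  rintro c ⟨φ, Q, k, hQ, hc, hdiv, hτ⟩
  set T : AddSubgroup (localPoints W E) := localTowerPointsOfEmb κ ι W with hT
  set A : AddSubgroup (localPoints W E) := ⨆ n : ℕ, signedLocalPointsOfEmb κ ι W 1 n with hA
  set A' : AddSubgroup T := A.addSubgroupOf T with hA'
  -- the quotient `T/A` has no `p`-torsion
  have hN : ∀ y : T ⧸ A', p • y = 0 → y = 0 := noPTorsion_towerQuotPlus κ ι W hnt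
  -- every functional of `T/A`, pulled back to `T`, lies in `Ker Col♭`
  have hker : ∀ zbar : T ⧸ A' →+ ℤ_[p],
      zbar.comp (QuotientAddGroup.mk' A') ∈ colemanKer κ ι W 0 g d .flat := by
    intro zbar
    refine mem_colemanKer_flat_of_forall_plus κ ι W hg hd htr _ fun n x hx => ?_
    have hx0 : (QuotientAddGroup.mk' A' x : T ⧸ A') = 0 := by
      rw [QuotientAddGroup.mk'_apply, QuotientAddGroup.eq_zero_iff, AddSubgroup.mem_addSubgroupOf]
      exact (le_iSup (fun n : ℕ => signedLocalPointsOfEmb κ ι W 1 n) n) hx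
    rw [AddMonoidHom.comp_apply, hx0, map_zero]
  -- so the image of `x = p^k Q` in `T/A` is divisible by `p^k`
  set x : T := ⟨p ^ k • Q, hQ⟩ with hx
  have hdvd : ∀ zbar : T ⧸ A' →+ ℤ_[p], (p : ℤ_[p]) ^ k ∣ zbar (QuotientAddGroup.mk x) := by
    intro zbar
    have h := hdiv _ (hker zbar)
    rwa [AddMonoidHom.comp_apply, QuotientAddGroup.mk'_apply] at h
  obtain ⟨ybar, hybar⟩ :=
    Literature.Algebra.Module.exists_nsmul_eq_of_forall_addMonoidHom_padicInt_dvd hN hdvd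
  obtain ⟨y, rfl⟩ := QuotientAddGroup.mk_surjective ybar
  -- `p^k Q − p^k y ∈ A`
  have hmem : p ^ k • Q - p ^ k • (y : localPoints W E) ∈ A := by
    have h1 : (QuotientAddGroup.mk (x - p ^ k • y) : T ⧸ A') = 0 := by
      rw [QuotientAddGroup.mk_sub, QuotientAddGroup.mk_nsmul, hybar, sub_self]
    rw [QuotientAddGroup.eq_zero_iff, AddSubgroup.mem_addSubgroupOf, AddSubgroupClass.coe_sub,
      AddSubgroupClass.coe_nsmul] at h1
    exact h1
  -- the translated witness `Q − y`
  refine ⟨φ, Q - y, k, hc, by rwa [smul_sub], fun τ => ?_⟩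
  have hy : (τ : Field.absoluteGaloisGroup E) • (y : localPoints W E) = y :=
    (mem_localTowerPointsOfEmb_iff κ ι W (y : localPoints W E)).1 y.2 τ τ.2
  rw [hτ τ, smul_sub, hy]
  abel

/-- **The two local conditions over `K_∞` COINCIDE at `a_p = 0`**: `E♭_∞ = (⨆ₙ E⁺_n) ⊗ ℚ_p/ℤ_p` inside `H¹(K_∞, E[p^∞])`
(restricted along `ι`), under `g`, (NT), (IDX) and the four Honda clauses (L) (TR) (GEN) (GEN₀) (file 17 §1 and §1 here).
[cite: Kobayashi2003, Thm. 6.2, Prop. 8.18–8.23] [cite: Sprung2012, Def. 7.9 (p. 1503)] -/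
theorem sharpFlatLocalKummer_eq_localKummerOverOfEmb_iSup_plus {g : Field.absoluteGaloisGroup E}
    (hg : κ.IsTopGenerator (resGalOfEmb ι g))
    (hnt : ∀ P ∈ localTowerPointsOfEmb κ ι W, p • P = 0 → P = 0)
    (hidx : ∀ m : ℕ, ((localLayerSubgroupOfEmb κ ι (m + 1)).subgroupOf (localLayerSubgroupOfEmb κ ι m)).index = p)
    {d : ℕ → localPoints W E} (hd : ∀ m, d m ∈ localLayerPointsOfEmb κ ι W m)
    (htr : ∀ m, localTraceOfEmb κ ι W (m + 1) (m + 2) (d (m + 2)) = -d m)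
    (hgen : ∀ m : ℕ, 1 ≤ m → ∀ P ∈ localLayerPointsOfEmb κ ι W m,
      ∃ B ∈ AddSubgroup.closure (Set.range fun σ : Field.absoluteGaloisGroup E ↦ σ • d m),
        ∃ P' ∈ localLayerPointsOfEmb κ ι W (m - 1), ∃ R ∈ localLayerPointsOfEmb κ ι W m, P = B + P' + p • R)
    (hgen0 : ∀ P ∈ localLayerPointsOfEmb κ ι W 0, ∃ a : ℤ, ∃ R ∈ localLayerPointsOfEmb κ ι W 0, P = a • d 0 + p • R) :
    sharpFlatLocalKummerOverOfEmb W p κ.kerSubgroup ι (localTowerPointsOfEmb κ ι W) (colemanKer κ ι W 0 g d .flat) =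
      localKummerOverOfEmb W p κ.kerSubgroup ι (⨆ n : ℕ, signedLocalPointsOfEmb κ ι W 1 n) :=
  le_antisymm (sharpFlatLocalKummer_le_localKummerOverOfEmb_iSup_plus κ ι W hg hnt hd htr)
    (localKummerOverOfEmb_iSup_plus_le_sharpFlatLocalKummer κ ι W κ.kerSubgroup hg hnt hidx hd htr hgen hgen0)

end Local

/-! ## §2 A class of `Sel♭(E/K_∞)` is plus-Kummer over `K_∞` at every conjugate -/

section Global

variable {K : Type u} [Field K] [NumberField K] (W : WeierstrassCurve K) {p : ℕ} [hp : Fact p.Prime]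
  (κ : ZpExtension K p)
variable {E : Type u} [Field E] [Algebra K E] (ι : AlgebraicClosure K →ₐ[K] AlgebraicClosure E)

/-- A class of Sprung's `Sel♭(E/K_∞)` (typed at the embedding `ι`) satisfies, at every conjugate `conj_σ`, Kobayashi's plus
Kummer condition over `K_∞` w.r.t. `⨆ₙ E⁺(K_n·K_v)` (§1 applied to the ♭ condition of `conj_σ s`).
[cite: Sprung2012, Def. 7.11 (p. 1503)] [cite: Kobayashi2003, Def. 1.1] -/
theorem conjH1_mem_localKummerOverOfEmb_iSup_plus_of_mem_sharpFlatSelmerInfty {g : Field.absoluteGaloisGroup E}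
    (hg : κ.IsTopGenerator (resGalOfEmb ι g))
    (hnt : ∀ P ∈ localTowerPointsOfEmb κ ι W, p • P = 0 → P = 0)
    {d : ℕ → localPoints W E} (hd : ∀ m, d m ∈ localLayerPointsOfEmb κ ι W m)
    (htr : ∀ m, localTraceOfEmb κ ι W (m + 1) (m + 2) (d (m + 2)) = -d m)
    {s : W.subgroupH1 p κ.kerSubgroup} (hs : s ∈ sharpFlatSelmerInfty W κ ι 0 g d .flat)
    (σ : Field.absoluteGaloisGroup K) :
    W.conjH1 p κ.kerSubgroup σ s ∈
      localKummerOverOfEmb W p κ.kerSubgroup ι (⨆ n : ℕ, signedLocalPointsOfEmb κ ι W 1 n) :=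
  sharpFlatLocalKummer_le_localKummerOverOfEmb_iSup_plus κ ι W hg hnt hd htr
    (((mem_sharpFlatSelmerInfty_iff W κ ι 0 g d .flat s).1 hs).2 σ)

end Global

/-! ## §3 `K = ℚ`, `p = 2`: `Sel♭(E/ℚ_∞) ≤ Sel⁺(E/ℚ_∞)` and equality on the habitat -/

section Rat

/-- **`Sel♭(E/ℚ_∞) ≤ Sel⁺(E/ℚ_∞)` at `p = 2`**, for ANY elliptic `W/ℚ`, any `ℤ₂`-extension `κ`, the place `v ∋ 2`, a local lift
`g` of the topological generator, (NT) on `E(ℚ_∞·ℚ_v)` and a Honda system `d` of `a_2 = 0` shape ((L), (TR)): the classical parts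
agree, the ♭ condition gives the plus Kummer condition over `ℚ_∞` at every conjugate (§2; `ℚ` has one place above `2`), and such a
class DESCENDS to some `Sel⁺(E/ℚ_m)` (`SignedTransportAtTwo.mem_signedSelmerInfty_of_mem_selmerInfty`).
[cite: Kobayashi2003, Def. 1.1] [cite: Sprung2012, Def. 7.11 (p. 1503)] [cite: GreenbergLNM1716, §3 Lemmas 3.2–3.3] -/
theorem sharpFlatSelmerInfty_flat_le_signedSelmerInfty_two (W : WeierstrassCurve ℚ) [W.IsElliptic] (κ : ZpExtension ℚ 2)
    (v : HeightOneSpectrum (𝓞 ℚ)) (hv : (2 : 𝓞 ℚ) ∈ v.asIdeal)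
    {g : Field.absoluteGaloisGroup (v.adicCompletion ℚ)}
    (hg : κ.IsTopGenerator (resGalOfEmb (closureEmb (K := ℚ) (v.adicCompletion ℚ)) g))
    (hnt : ∀ P ∈ localTowerPointsOfEmb κ (closureEmb (K := ℚ) (v.adicCompletion ℚ)) W, 2 • P = 0 → P = 0)
    {d : ℕ → localPoints W (v.adicCompletion ℚ)}
    (hd : ∀ m, d m ∈ localLayerPoints κ (v.adicCompletion ℚ) W m)
    (htr : ∀ m, localTrace κ (v.adicCompletion ℚ) W (m + 1) (m + 2) (d (m + 2)) = -d m) :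
    sharpFlatSelmerInfty W κ (closureEmb (K := ℚ) (v.adicCompletion ℚ)) 0 g d .flat ≤ signedSelmerInfty W κ 1 := by
  intro s hs
  refine SignedTransportAtTwo.mem_signedSelmerInfty_of_mem_selmerInfty W κ s
    (sharpFlatSelmerInfty_le_selmerInfty W κ _ 0 g d .flat hs) fun v' hv' σ => ?_
  obtain rfl : v = v' := heightOneSpectrum_eq_of_natCast_mem Nat.prime_two (by exact_mod_cast hv) hv'
  exact conjH1_mem_localKummerOverOfEmb_iSup_plus_of_mem_sharpFlatSelmerInfty W κ _ hg hnt hd htr hs σ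

/-- **`Sel⁺(E/ℚ_∞) = Sel♭(E/ℚ_∞)` AT `p = 2` on the theta habitat, modulo HONDA⁺@2.** For `W/ℚ` globally minimal with `GoodSS W 2`,
the CYCLOTOMIC `κ`, the place `v ∋ 2`, a local lift `g` and a plus Honda system `d` at `2` ((L) (TR) (GEN) (GEN₀) — the body of K4's
`stub_plusHondaSystemTwo` at (`W`, `κ`, `v`)): Kobayashi's and Sprung's Selmer groups over `ℚ_∞` coincide ((NT): the `bsd-2adic`
cell's tower torsion at `2`; (IDX): the K4 seats' layer degrees). [cite: Kobayashi2003, Def. 1.1, Thm. 6.2]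
[cite: Sprung2012, §1 p. 1486, Def. 7.11, Thm. 7.14] [cite: KuriharaOtsuki2006, p. 557] -/
theorem signedSelmerInfty_eq_sharpFlatSelmerInfty_flat_two (W : WeierstrassCurve ℚ) [W.IsElliptic] [W.IsGloballyMinimal]
    (hss : GoodSS W 2) {κ : ZpExtension ℚ 2} (hκ : κ.IsCyclotomic) (v : HeightOneSpectrum (𝓞 ℚ)) (hv : (2 : 𝓞 ℚ) ∈ v.asIdeal)
    {g : Field.absoluteGaloisGroup (v.adicCompletion ℚ)}
    (hg : κ.IsTopGenerator (resGalOfEmb (closureEmb (K := ℚ) (v.adicCompletion ℚ)) g))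
    {d : ℕ → localPoints W (v.adicCompletion ℚ)}
    (hd : ∀ m, d m ∈ localLayerPoints κ (v.adicCompletion ℚ) W m)
    (htr : ∀ m, localTrace κ (v.adicCompletion ℚ) W (m + 1) (m + 2) (d (m + 2)) = -d m)
    (hgen : ∀ m : ℕ, 1 ≤ m → ∀ P ∈ localLayerPoints κ (v.adicCompletion ℚ) W m,
      ∃ B ∈ AddSubgroup.closure (Set.range fun σ : Field.absoluteGaloisGroup (v.adicCompletion ℚ) ↦ σ • d m),
        ∃ P' ∈ localLayerPoints κ (v.adicCompletion ℚ) W (m - 1),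
          ∃ R ∈ localLayerPoints κ (v.adicCompletion ℚ) W m, P = B + P' + 2 • R)
    (hgen0 : ∀ P ∈ localLayerPoints κ (v.adicCompletion ℚ) W 0,
      ∃ a : ℤ, ∃ R ∈ localLayerPoints κ (v.adicCompletion ℚ) W 0, P = a • d 0 + 2 • R) :
    signedSelmerInfty W κ 1 = sharpFlatSelmerInfty W κ (closureEmb (K := ℚ) (v.adicCompletion ℚ)) 0 g d .flat :=
  le_antisymm (signedSelmerInfty_le_sharpFlatSelmerInfty_flat_two W hss hκ v hv hg hd htr hgen hgen0)
    (sharpFlatSelmerInfty_flat_le_signedSelmerInfty_two W κ v hv hg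
      (fun _ hP h2 => SSFlatEC.eq_zero_of_mem_localTowerPointsOfEmb_of_two_nsmul W hss κ hv _ hP h2) hd htr)

end Rat

/-! ## §4 Under `Sel⁺ = Sel♭`: `X♭ ≃ X⁺` on the pinned duals (any `K`, `p`) -/

section DualIso

variable {K : Type u} [Field K] [NumberField K] (W : WeierstrassCurve K) {p : ℕ} [hp : Fact p.Prime]
  (κ : ZpExtension K p)
variable {E : Type u} [Field E] [Algebra K E] (ι : AlgebraicClosure K →ₐ[K] AlgebraicClosure E)
  (g : Field.absoluteGaloisGroup E) (d : ℕ → localPoints W E) {γ : Field.absoluteGaloisGroup K}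

/-- Under `Sel⁺ = Sel♭` the restriction `r : X♭ → X⁺` of file 18 (`D.toDual (r x) = D♭.toDual x ∘ incl`) is INJECTIVE: a
character of `Sel♭` vanishing on `Sel⁺ = Sel♭` vanishes. [cite: Sprung2012, Def. 7.11 (p. 1503)] -/
theorem flatToPlusRestrict_injective (heq : signedSelmerInfty W κ 1 = sharpFlatSelmerInfty W κ ι 0 g d .flat)
    (Df : SharpFlatSelmerDualData W κ γ ι 0 g d .flat) (D : SignedSelmerDualData W κ γ 1)
    (r : Df.X →ₗ[IwasawaAlgebra p] D.X)
    (hr : ∀ (x : Df.X) (s : signedSelmerInfty W κ 1),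
      D.toDual (r x) s = Df.toDual x (AddSubgroup.inclusion heq.le s)) :
    Function.Injective r := by
  intro x₁ x₂ h
  apply Df.bijective.injective
  ext s
  have hs : (s : W.subgroupH1 p κ.kerSubgroup) ∈ signedSelmerInfty W κ 1 := heq.ge s.2
  have e : AddSubgroup.inclusion heq.le ⟨(s : W.subgroupH1 p κ.kerSubgroup), hs⟩ = s := Subtype.ext rfl
  have h' := congrArg (fun y : D.X => D.toDual y ⟨(s : W.subgroupH1 p κ.kerSubgroup), hs⟩) h
  simp only [hr, e] at h'
  exact h'

/-- **`X♭ ≃ X⁺` as `Λ`-modules** for every pinned pair (`D♭`, `D`) under `Sel⁺ = Sel♭` (file 18's `r` is onto and, here, into).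
[cite: Sprung2012, Def. 7.11 and Thm. 7.14 (pp. 1503–1504)] [cite: Kobayashi2003, Thm. 1.2] -/
theorem nonempty_linearEquiv_sharpFlat_signed (heq : signedSelmerInfty W κ 1 = sharpFlatSelmerInfty W κ ι 0 g d .flat)
    (Df : SharpFlatSelmerDualData W κ γ ι 0 g d .flat) (D : SignedSelmerDualData W κ γ 1) :
    Nonempty (Df.X ≃ₗ[IwasawaAlgebra p] D.X) := by
  obtain ⟨r, hr⟩ := exists_flatToPlusRestrict W κ ι g d heq.le Df D
  exact ⟨LinearEquiv.ofBijective r ⟨flatToPlusRestrict_injective W κ ι g d heq Df D r hr,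
    flatToPlusRestrict_surjective W κ ι g d heq.le Df D r hr⟩⟩

/-- **`ℓ_𝔭(X♭) = ℓ_𝔭(X⁺)`** at every prime `𝔭` of `Λ`, under `Sel⁺ = Sel♭`. [cite: Sprung2012, Thm. 7.14 (p. 1504)] -/
theorem lengthAt_sharpFlat_eq_lengthAt_signed (heq : signedSelmerInfty W κ 1 = sharpFlatSelmerInfty W κ ι 0 g d .flat)
    (Df : SharpFlatSelmerDualData W κ γ ι 0 g d .flat) (D : SignedSelmerDualData W κ γ 1)
    (𝔭 : PrimeSpectrum (IwasawaAlgebra p)) :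
    lengthAt (IwasawaAlgebra p) Df.X 𝔭 = lengthAt (IwasawaAlgebra p) D.X 𝔭 := by
  obtain ⟨e⟩ := nonempty_linearEquiv_sharpFlat_signed W κ ι g d heq Df D
  exact lengthAt_eq_of_linearEquiv e 𝔭

/-- **`Char(X♭) = Char(X⁺)`** under `Sel⁺ = Sel♭` (the characteristic ideals are read off the height-one lengths).
[cite: Sprung2012, Thm. 7.14 and Main Conj. 7.21 (the objects only)] [cite: Kobayashi2003, Thm. 1.2] -/
theorem charIdeal_sharpFlat_eq_charIdeal_signed (heq : signedSelmerInfty W κ 1 = sharpFlatSelmerInfty W κ ι 0 g d .flat)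
    (Df : SharpFlatSelmerDualData W κ γ ι 0 g d .flat) (D : SignedSelmerDualData W κ γ 1) :
    Df.charIdeal = D.charIdeal := by
  obtain ⟨e⟩ := nonempty_linearEquiv_sharpFlat_signed W κ ι g d heq Df D
  unfold SharpFlatSelmerDualData.charIdeal SignedSelmerDualData.charIdeal Module.charIdeal
  simp only [lengthAt_eq_of_linearEquiv e]

/-- `X♭` is `Λ`-torsion iff `X⁺` is, under `Sel⁺ = Sel♭`. [cite: Sprung2012, Thm. 7.14 (p. 1504)] [cite: Kobayashi2003, Thm. 1.2] -/
theorem isTorsion_sharpFlat_iff_isTorsion_signed (heq : signedSelmerInfty W κ 1 = sharpFlatSelmerInfty W κ ι 0 g d .flat)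
    (Df : SharpFlatSelmerDualData W κ γ ι 0 g d .flat) (D : SignedSelmerDualData W κ γ 1) :
    Module.IsTorsion (IwasawaAlgebra p) Df.X ↔ Module.IsTorsion (IwasawaAlgebra p) D.X := by
  obtain ⟨e⟩ := nonempty_linearEquiv_sharpFlat_signed W κ ι g d heq Df D
  constructor
  · intro h y
    obtain ⟨a, ha⟩ := @h (e.symm y)
    refine ⟨a, ?_⟩
    have ha' : (a : IwasawaAlgebra p) • e.symm y = 0 := ha
    show (a : IwasawaAlgebra p) • y = 0
    rw [← e.apply_symm_apply y, ← map_smul, ha', map_zero]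
  · intro h x
    obtain ⟨a, ha⟩ := @h (e x)
    refine ⟨a, ?_⟩
    have ha' : (a : IwasawaAlgebra p) • e x = 0 := ha
    show (a : IwasawaAlgebra p) • x = 0
    rw [← e.symm_apply_apply x, ← map_smul, ha', map_zero]

end DualIso

/-! ## §5 `p = 2` on the habitat: the ♭ road loses nothing -/

section RatDual

variable (W : WeierstrassCurve ℚ) [W.IsElliptic] [W.IsGloballyMinimal]

/-- **`ℓ_𝔭(X♭(E/ℚ_∞)) = ℓ_𝔭(X⁺(E/ℚ_∞))` AT `p = 2`** on the theta habitat, modulo HONDA⁺@2 and a local lift `g`, for EVERY pinned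
`D : SignedSelmerDualData W κ γ 1` (K3's object) and EVERY pinned `D♭ : SharpFlatSelmerDualData W κ γ (closureEmb ℚ_v) 0 g d .flat`.
[cite: Sprung2012, Thm. 7.14 (p. 1504)] [cite: Kobayashi2003, Thm. 1.2] [cite: KuriharaOtsuki2006, p. 557] -/
theorem lengthAt_sharpFlat_eq_lengthAt_signed_two (hss : GoodSS W 2) {κ : ZpExtension ℚ 2} (hκ : κ.IsCyclotomic)
    {γ : Field.absoluteGaloisGroup ℚ} (v : HeightOneSpectrum (𝓞 ℚ)) (hv : (2 : 𝓞 ℚ) ∈ v.asIdeal)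
    {g : Field.absoluteGaloisGroup (v.adicCompletion ℚ)}
    (hg : κ.IsTopGenerator (resGalOfEmb (closureEmb (K := ℚ) (v.adicCompletion ℚ)) g))
    {d : ℕ → localPoints W (v.adicCompletion ℚ)}
    (hd : ∀ m, d m ∈ localLayerPoints κ (v.adicCompletion ℚ) W m)
    (htr : ∀ m, localTrace κ (v.adicCompletion ℚ) W (m + 1) (m + 2) (d (m + 2)) = -d m)
    (hgen : ∀ m : ℕ, 1 ≤ m → ∀ P ∈ localLayerPoints κ (v.adicCompletion ℚ) W m,
      ∃ B ∈ AddSubgroup.closure (Set.range fun σ : Field.absoluteGaloisGroup (v.adicCompletion ℚ) ↦ σ • d m),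
        ∃ P' ∈ localLayerPoints κ (v.adicCompletion ℚ) W (m - 1),
          ∃ R ∈ localLayerPoints κ (v.adicCompletion ℚ) W m, P = B + P' + 2 • R)
    (hgen0 : ∀ P ∈ localLayerPoints κ (v.adicCompletion ℚ) W 0,
      ∃ a : ℤ, ∃ R ∈ localLayerPoints κ (v.adicCompletion ℚ) W 0, P = a • d 0 + 2 • R)
    (D : SignedSelmerDualData W κ γ 1)
    (Df : SharpFlatSelmerDualData W κ γ (closureEmb (K := ℚ) (v.adicCompletion ℚ)) 0 g d .flat)
    (𝔭 : PrimeSpectrum (IwasawaAlgebra 2)) :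
    lengthAt (IwasawaAlgebra 2) Df.X 𝔭 = lengthAt (IwasawaAlgebra 2) D.X 𝔭 :=
  lengthAt_sharpFlat_eq_lengthAt_signed W κ _ g d
    (signedSelmerInfty_eq_sharpFlatSelmerInfty_flat_two W hss hκ v hv hg hd htr hgen hgen0) Df D 𝔭

/-- **`Char(X♭(E/ℚ_∞)) = Char(X⁺(E/ℚ_∞))` AT `p = 2`** on the theta habitat, modulo HONDA⁺@2 and `g`, for every pinned pair.
[cite: Sprung2012, Thm. 7.14, Main Conj. 7.21 (the objects only)] [cite: Kobayashi2003, Thm. 1.2] -/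
theorem charIdeal_sharpFlat_eq_charIdeal_signed_two (hss : GoodSS W 2) {κ : ZpExtension ℚ 2} (hκ : κ.IsCyclotomic)
    {γ : Field.absoluteGaloisGroup ℚ} (v : HeightOneSpectrum (𝓞 ℚ)) (hv : (2 : 𝓞 ℚ) ∈ v.asIdeal)
    {g : Field.absoluteGaloisGroup (v.adicCompletion ℚ)}
    (hg : κ.IsTopGenerator (resGalOfEmb (closureEmb (K := ℚ) (v.adicCompletion ℚ)) g))
    {d : ℕ → localPoints W (v.adicCompletion ℚ)}
    (hd : ∀ m, d m ∈ localLayerPoints κ (v.adicCompletion ℚ) W m)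
    (htr : ∀ m, localTrace κ (v.adicCompletion ℚ) W (m + 1) (m + 2) (d (m + 2)) = -d m)
    (hgen : ∀ m : ℕ, 1 ≤ m → ∀ P ∈ localLayerPoints κ (v.adicCompletion ℚ) W m,
      ∃ B ∈ AddSubgroup.closure (Set.range fun σ : Field.absoluteGaloisGroup (v.adicCompletion ℚ) ↦ σ • d m),
        ∃ P' ∈ localLayerPoints κ (v.adicCompletion ℚ) W (m - 1),
          ∃ R ∈ localLayerPoints κ (v.adicCompletion ℚ) W m, P = B + P' + 2 • R)
    (hgen0 : ∀ P ∈ localLayerPoints κ (v.adicCompletion ℚ) W 0,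
      ∃ a : ℤ, ∃ R ∈ localLayerPoints κ (v.adicCompletion ℚ) W 0, P = a • d 0 + 2 • R)
    (D : SignedSelmerDualData W κ γ 1)
    (Df : SharpFlatSelmerDualData W κ γ (closureEmb (K := ℚ) (v.adicCompletion ℚ)) 0 g d .flat) :
    Df.charIdeal = D.charIdeal :=
  charIdeal_sharpFlat_eq_charIdeal_signed W κ _ g d
    (signedSelmerInfty_eq_sharpFlatSelmerInfty_flat_two W hss hκ v hv hg hd htr hgen hgen0) Df D

end RatDual

end SignedKatoOffTwo.FlatKernel

end Summit.BirchSwinnertonDyer.BirchSwinnertonDyer.Theorems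

end
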